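import Literature.MathematicalPhysics.QuantumFieldTheory.Balaban1983to89.B4Prop31Charts
import Literature.MathematicalPhysics.QuantumFieldTheory.Balaban1983to89.B4Sect3BlockAveraging
import Literature.MathematicalPhysics.QuantumFieldTheory.Balaban1983to89.B4Cor23Rep36Bridge

/-!
# `Balaban1983to89.B4NextAvg52` — T. Bałaban, *Regularity and decay of lattice Green's functions*, Commun. Math.
# Phys. **89** (1983) 571–597 [Balaban1983RegularityDecay] (= B4), p. 593 (5.2)–(5.3): the next-level `L`-block
# averaging `Q(A)` on the unit lattice `Ω^{(k)}` and its projection `P(A) = Q^*(A)Q(A)` AT A GENERAL VECTOR FIELD `A`,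
# typed as b04's averaging machinery at mesh parameter `L` (the objects of the p. 593 lower-bound argument; the bound
# itself at a regular `A ≠ 0` is `B4Ineq53RegularRegion.block_lower_regular`)

statement-level skeleton of published theorems with citation tags; proofs where landed; nothing here is a claim about the Yang–Mills mass gap

PDF held: `paper:balaban1983-cmp89-regularity-decay` (journal page = PDF page + 570); pp. 572, 574, 587, 593 [PDF 2, 4,
17, 23] read on the ×2 renders `…/b2b-balaban-ref1/pages/1983-cmp89-regularity-decay/…-p0NN-x2.png`.

CITATION HEADER (lean-in-tree rule).  Cell `lit-balaban` (HOME `run/shared/lean/pub/lit-balaban/`), Phase-2 proof seat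
**p17** gen 3 (unit `lit-balaban-p17-g3`), file 1/3 of the MODEL INSTANCE of SKELETON row **B4.Prop2.3[I]**
(`B4.Prop23Printed`, «Proposition 2.3 of [1]», owner r01, referee ref-4) AT A REGULAR `A ≠ 0` by the printed §5 route
pp. 593–594.  REPRODUCED here: the object `P(A)` of (1.13)/(1.15)/(5.1) as written out at (5.2), and the block step
(5.2) ⇒ (5.3).  USED BY NAME, never restated: b04 (`B4Lower18.fineDom`, `B4Lower18RegularRegion.{regWt, rBlkWt,
compField, blockConst, lower18_regular_region_stair}`), p35 (`B4Prop31Charts.{linkR, transR, covDiffSq}`,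
`B4Prop31Holonomy.{base, segSum, clink}`), r01 (`B4GaussRep36.{pOp, RowOrtho}`, `B4Sect3BlockAveraging.rowOrtho_avgOp`),
p17 gen 2 (`B4Cor23Rep36Bridge.{blkR, card_blkR}`).

WHAT IS PRINTED (p. 593 [PDF 23], verbatim up to OCR): *"⟨φ, (Δ^{(k)}(Ω,A) + aL^{−2}P(A))φ⟩ ≥ γ₀ Σ_{⟨x,x′⟩⊂Ω^{(k)}}
|U(A(⟨x,x′⟩))φ(x′) − φ(x)|² + aL^{d−2} Σ_{y∈Ω^{(k+1)}} |L^{−d} Σ_{x∈B(y)} U(A(Γ_{y,x}))φ(x)|² − O(e^{2−δ}) Σ_{x∈Ω^{(k)}}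
|φ(x)|².  (5.2)  Now we use again the method we have applied so many times: in the expression on the right hand side
above we separate the blocks by Neumann boundary conditions, in each block we decompose A = A₀ + A′ into a constant
field A₀ and small field A′ and we expand with respect to A′ getting the same expression with A₀ instead of A and a
bigger constant in the last sum. Next we "gauge away" the constant field, and we obtain the Laplace operator with
Neumann boundary conditions for each block plus the projection operator on constant functions. This sum is bounded from
below by a positive constant (more precisely by ½γ₀min{π²L^{−2}, aL^{−2}}), thus we have … ≥ γ₀″⟨φ,φ⟩. (5.3)"*

DICTIONARY (lattice units, as b04/p35; readings, not quotations; here `d ↦ d+1`).  `η = 1/n`; `Ω^{(k)}` = a finite union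
of `L`-blocks of unit sites INDEXED BY ITS `L`-BLOCK LABELS `Zc = Ω^{(k+1)} ⊂ ℤ^{d+1}`: `Ω^{(k)} = fineDom L Zc`, `Ω =
fineDom n (fineDom L Zc)`; `U(A(⟨x,x+e_μ⟩)) = clink = F.U(κ·uField n A x μ)`, `κ = eη`, `uField n A x μ = A([n·x,
n·x+n·e_μ])` — so the unit lattice IS b04's «region over `Zc` with mesh parameter `L`» for the field `uField n A`;
`U(A(Γ_{y,x}))`, `y ∈ Ω^{(k+1)}`, `x ∈ B(y)` = the transporter of `uField n A` along b04's staircase `L·y → x` (`transR … L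
Zc (uField n A)`; the print's fine contour is the concatenation of the unit steps' straight fine contours);
`Q(A)φ(y) = L^{−d}Σ_{x∈B(y)}U(A(Γ_{y,x}))φ(x)` = `nextAvg`; `P(A) = Q^*(A)Q(A)` (adjoint for the `L^d`-weighted sum over
`Ω^{(k+1)}`) = r01's `pOp L^{d+1} nextAvg = L^{d+1}QᵀQ`, `⟨φ,P(A)φ⟩` = the middle sum of (5.2) without `aL^{−2}`.

WHAT IS KERNEL-CHECKED (zero `sorry`, standard axioms; no `Prop`-valued definition): §1 `uField`, `linkR_uField_step`;
§2 `nextAvg` (= `Q(A)`), `rowOrtho_nextAvg` (`QQᵀ = L^{−(d+1)}·1`, so `P(A)` is an orthogonal projection),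
`pOp_nextAvg_form`, `pOp_nextAvg_apply_ne_zero` (`P(A;x,x′) ≠ 0 ⇒` same `L`-block); §3 `covLap_unit_form` (b04's bond
form (1.3) of the unit lattice with mesh `L` and links `uField n A` IS `L²·`(first sum of (5.2)) = `L²·covDiffSq`).
The block step (5.2) ⇒ (5.3) itself — b04's (1.8)-for-regular-fields APPLIED to the unit lattice as the region of mesh
`L` over `Ω^{(k+1)}` with the field `uField n A` — and (1.15) at a regular `A ≠ 0` are in the sibling
`B4Ineq53RegularRegion` (file 2/3).  Unit `lit-balaban-p17-g3`, HOME as above.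
-/

namespace Literature.MathematicalPhysics.QuantumFieldTheory.Balaban1983to89.B4NextAvg52

open Finset Matrix
open Literature.MathematicalPhysics.QuantumFieldTheory.Balaban1983to89
open Literature.MathematicalPhysics.QuantumFieldTheory.Balaban1983to89.B4GaugeCovariance (OrthFlow avgOp blockOp_apply
  covLap covLap_form projOp projOp_form fieldLink contourTrans transport fld)
open Literature.MathematicalPhysics.QuantumFieldTheory.Balaban1983to89.B4Lower18Regular (transport_fieldLink
  orth_dotProduct_mulVec_self e1)
open Literature.MathematicalPhysics.QuantumFieldTheory.Balaban1983to89.B4Lower18RegularRegion (regWt rBlkWt compField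
  compField_add ne_add_e1_add_e1 e1_inj)
open Literature.MathematicalPhysics.QuantumFieldTheory.Balaban1983to89.B4Reflection242 (nbrs blk mem_nbrs)
open Literature.MathematicalPhysics.QuantumFieldTheory.Balaban1983to89.B4Lower18 (fineDom)
open Literature.MathematicalPhysics.QuantumFieldTheory.Balaban1983to89.B4Prop31Holonomy (base segSum clink clink_eq)
open Literature.MathematicalPhysics.QuantumFieldTheory.Balaban1983to89.B4Prop31Charts (linkR transR covDiffSq
  sum_subtype_ite_eq)
open Literature.MathematicalPhysics.QuantumFieldTheory.Balaban1983to89.B4GaussRep36 (pOp RowOrtho)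
open Literature.MathematicalPhysics.QuantumFieldTheory.Balaban1983to89.B4Sect3BlockAveraging (rowOrtho_avgOp
  avgOp_apply_ne_zero)
open Literature.MathematicalPhysics.QuantumFieldTheory.Balaban1983to89.B4Cor23Rep36Bridge (blkR card_blkR)

noncomputable section

variable {d : ℕ} {ι : Type} [Fintype ι] [DecidableEq ι]

/-! ## §1. The unit-lattice vector field `A(⟨x, x+e_μ⟩)` induced by the fine field -/

/-- **THE UNIT-LATTICE VECTOR FIELD OF (5.2)**: `A(⟨x, x+e_μ⟩) = Σ_{b ⊂ [n·x, n·x+n·e_μ]} A_b`, the field summed along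
the straight fine contour of the unit bond (so that `U(A(⟨x,x+e_μ⟩)) = F.U(κ·A(⟨x,x+e_μ⟩))`, `clink_eq`), as a vector
field in component form on the unit lattice `ℤ^{d+1}`. [cite: Balaban1983RegularityDecay, p. 593 (5.2) «U(A(⟨x,x′⟩))», p. 574 (1.22)] -/
def uField (n : ℕ) (Ac : (Fin (d + 1) → ℤ) → Fin (d + 1) → ℝ) : (Fin (d + 1) → ℤ) → Fin (d + 1) → ℝ :=
  fun x μ => segSum Ac μ (base n x) n

/-- `uField n A x μ = A([n·x, n·x + n·e_μ])`. [cite: Balaban1983RegularityDecay, p. 593 (5.2)] -/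
theorem uField_apply (n : ℕ) (Ac : (Fin (d + 1) → ℤ) → Fin (d + 1) → ℝ) (x : Fin (d + 1) → ℤ) (μ : Fin (d + 1)) :
    uField n Ac x μ = segSum Ac μ (base n x) n := rfl

/-- `U(A(⟨x, x+e_μ⟩)) = F.U(κ·uField n A x μ)`. [cite: Balaban1983RegularityDecay, p. 593 (5.2), p. 574 (1.22)] -/
theorem clink_eq_uField (F : OrthFlow ι) (κ : ℝ) (Ac : (Fin (d + 1) → ℤ) → Fin (d + 1) → ℝ) (n : ℕ)
    (x : Fin (d + 1) → ℤ) (μ : Fin (d + 1)) : clink F κ Ac n x μ = F.U (κ * uField n Ac x μ) :=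
  clink_eq F κ Ac n x μ

/-- antisymmetry of a vector field in bond form. [folklore] -/
private theorem compField_swap (Ac : (Fin (d + 1) → ℤ) → Fin (d + 1) → ℝ) (x x' : Fin (d + 1) → ℤ) :
    compField Ac x' x = -compField Ac x x' := by
  unfold compField
  ring

section Unit

variable (F : OrthFlow ι) (κ : ℝ) {L : ℕ} (hL : 1 ≤ L) (Zc : Finset (Fin (d + 1) → ℤ)) (n : ℕ)
  (Ac : (Fin (d + 1) → ℤ) → Fin (d + 1) → ℝ)

/-- **b04's LINK VARIABLE OF THE UNIT LATTICE (mesh parameter `L`, labels `Ω^{(k+1)} = Zc`, field `uField n A`) ON THE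
BOND `(x, x+e_μ)` IS THE `U(A(⟨x,x+e_μ⟩))` OF (5.2).** [cite: Balaban1983RegularityDecay, p. 593 (5.2), p. 572 (1.2)] -/
theorem linkR_uField_step (x x' : ↥(fineDom L Zc)) {μ : Fin (d + 1)} (h : x'.1 = x.1 + e1 μ) :
    linkR F κ L Zc (uField n Ac) x x' = clink F κ Ac n x.1 μ := by
  simp only [linkR, fieldLink]
  rw [h, compField_add, clink_eq]
  rfl

/-! ## §2. The next-level averaging `Q(A)` of (5.2) and the projection `P(A) = Q^*(A)Q(A)` -/

/-- the weights `L^{−(d+1)}·1[x ∈ B(y)]` of `Q(A)` (print: `L^{−d}`, `x ∈ B(y)`). [cite: Balaban1983RegularityDecay, p. 593 (5.2), p. 587 (3.2)] -/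
def qL (L : ℕ) (Zc : Finset (Fin (d + 1) → ℤ)) (y : ↥Zc) (x : ↥(fineDom L Zc)) : ℝ :=
  (((L ^ (d + 1) : ℕ) : ℝ))⁻¹ * rBlkWt L Zc (fineDom L Zc) y x

/-- **`Q(A)` OF (5.2)/(3.2)**: `(Q(A)φ)(y) = L^{−d}Σ_{x∈B(y)} U(A(Γ_{y,x}))φ(x)`, `y ∈ Ω^{(k+1)}`, on unit-lattice fields
`φ : Ω^{(k)} → R^N` — the transporters along b04's staircase contours from `L·y` to `x` for the unit-lattice field
`uField n A` (= `U(A(Γ_{y,x}))` for the fine staircase through the unit points). [cite: Balaban1983RegularityDecay, p. 593 (5.2), p. 587 (3.2)] -/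
def nextAvg : Matrix (↥Zc × ι) (↥(fineDom L Zc) × ι) ℝ :=
  avgOp (qL L Zc) (transR F κ hL Zc (uField n Ac))

/-- `Q(A) = L^{−(d+1)}·(transported block sums)`. [cite: Balaban1983RegularityDecay, p. 593 (5.2)] -/
theorem nextAvg_eq_smul : nextAvg F κ hL Zc n Ac
    = (((L ^ (d + 1) : ℕ) : ℝ))⁻¹ • avgOp (rBlkWt L Zc (fineDom L Zc)) (transR F κ hL Zc (uField n Ac)) := by
  ext ⟨y, i⟩ ⟨x, j⟩
  simp only [nextAvg, avgOp, blockOp_apply, Matrix.smul_apply, smul_eq_mul, qL, mul_assoc]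

/-- the weight vanishes off the block. [cite: Balaban1983RegularityDecay, p. 587 (3.2)] -/
theorem qL_off (y : ↥Zc) (x : ↥(fineDom L Zc)) (h : blkR hL Zc x ≠ y) : qL L Zc y x = 0 := by
  unfold qL rBlkWt
  rw [if_neg, mul_zero]
  exact fun hb => h (Subtype.ext hb)

/-- the weight on the block is `L^{−(d+1)}`. [cite: Balaban1983RegularityDecay, p. 587 (3.2)] -/
theorem qL_diag (x : ↥(fineDom L Zc)) : qL L Zc (blkR hL Zc x) x = (((L ^ (d + 1) : ℕ) : ℝ))⁻¹ := by
  unfold qL rBlkWt blkR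
  rw [if_pos rfl, mul_one]

/-- the unit-lattice block transporters are orthogonal: `U(A(Γ))U(A(Γ))ᵀ = 1`. [cite: Balaban1983RegularityDecay, p. 572 (1.2), (1.4)] -/
theorem transR_mul_transpose (Au : (Fin (d + 1) → ℤ) → Fin (d + 1) → ℝ) (y : ↥Zc) (x : ↥(fineDom L Zc)) :
    transR F κ hL Zc Au y x * (transR F κ hL Zc Au y x)ᵀ = 1 := by
  unfold transR contourTrans linkR
  rw [transport_fieldLink, F.transpose_eq, ← F.map_add, add_neg_cancel, F.map_zero]

/-- **`Q(A)Q(A)ᵀ = L^{−(d+1)}·1`** (r01's `RowOrtho L^{d+1} Q(A)`: the rows are orthogonal with square norm `L^{−(d+1)}`, the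
plain form of p. 588 *"The L²-norms of the functions … q_{k+1}(y) are equal to … L^{−d/2}"*), so `P(A) = L^{d+1}QᵀQ` is an
orthogonal projection. [cite: Balaban1983RegularityDecay, p. 593 (5.2), p. 588] -/
theorem rowOrtho_nextAvg : RowOrtho (((L ^ (d + 1) : ℕ) : ℝ)) (nextAvg F κ hL Zc n Ac) :=
  rowOrtho_avgOp (blkR hL Zc) (qL L Zc) (transR F κ hL Zc (uField n Ac)) (L ^ (d + 1)) (qL_off hL Zc)
    (qL_diag hL Zc) (card_blkR hL Zc) fun x => transR_mul_transpose F κ hL Zc (uField n Ac) (blkR hL Zc x) x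

/-- `⟨φ, P(A)φ⟩ = L^{−(d+1)}·Σ_y |Σ_{x∈B(y)}U(A(Γ_{y,x}))φ(x)|²` (`= L^{d}Σ_y|Q(A)φ(y)|²`, the middle sum of (5.2) without
its factor `aL^{−2}`). [cite: Balaban1983RegularityDecay, p. 593 (5.2)] -/
theorem pOp_nextAvg_form (ψ : ↥(fineDom L Zc) × ι → ℝ) :
    ψ ⬝ᵥ (pOp (((L ^ (d + 1) : ℕ) : ℝ)) (nextAvg F κ hL Zc n Ac) *ᵥ ψ)
      = (((L ^ (d + 1) : ℕ) : ℝ))⁻¹ *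
          ((avgOp (rBlkWt L Zc (fineDom L Zc)) (transR F κ hL Zc (uField n Ac)) *ᵥ ψ) ⬝ᵥ
            (avgOp (rBlkWt L Zc (fineDom L Zc)) (transR F κ hL Zc (uField n Ac)) *ᵥ ψ)) := by
  have hL0 : (((L ^ (d + 1) : ℕ) : ℝ)) ≠ 0 := by
    have : 0 < L ^ (d + 1) := pow_pos hL _
    exact_mod_cast this.ne'
  rw [pOp, nextAvg_eq_smul, Matrix.transpose_smul, Matrix.smul_mul, Matrix.mul_smul, smul_smul, smul_smul,
    ← projOp, Matrix.smul_mulVec, dotProduct_smul, smul_eq_mul, projOp_form]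
  congr 1
  field_simp

/-- `P(A; x, x′) ≠ 0` only for `x, x′` in the same `L`-block. [cite: Balaban1983RegularityDecay, p. 593 (5.2), p. 574 (1.15)] -/
theorem pOp_nextAvg_apply_ne_zero {p q : ↥(fineDom L Zc) × ι}
    (h : pOp (((L ^ (d + 1) : ℕ) : ℝ)) (nextAvg F κ hL Zc n Ac) p q ≠ 0) : blk L p.1.1 = blk L q.1.1 := by
  rw [pOp, Matrix.smul_apply, Matrix.mul_apply, smul_eq_mul] at h
  obtain ⟨r, -, hr⟩ := Finset.exists_ne_zero_of_sum_ne_zero (right_ne_zero_of_mul h)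
  rw [Matrix.transpose_apply] at hr
  have h1 := avgOp_apply_ne_zero (qL_off hL Zc) (transR F κ hL Zc (uField n Ac)) (left_ne_zero_of_mul hr)
  have h2 := avgOp_apply_ne_zero (qL_off hL Zc) (transR F κ hL Zc (uField n Ac)) (right_ne_zero_of_mul hr)
  exact (congrArg Subtype.val h1).trans (congrArg Subtype.val h2).symm

/-! ## §3. b04's bond form of the unit lattice is `L²` times the covariant bond sum of (5.2)/(1.22) -/

/-- moving the innermost of three sums outermost. [folklore] -/
private theorem sum_sum_sum_comm3 {α β γ : Type*} [Fintype α] [Fintype β] [Fintype γ] (f : α → β → γ → ℝ) :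
    ∑ a, ∑ b, ∑ c, f a b c = ∑ c, ∑ a, ∑ b, f a b c :=
  calc ∑ a, ∑ b, ∑ c, f a b c = ∑ a, ∑ c, ∑ b, f a b c := Finset.sum_congr rfl fun _ _ => Finset.sum_comm
    _ = ∑ c, ∑ a, ∑ b, f a b c := Finset.sum_comm

/-- pointwise: the nearest-neighbour indicator splits into the `2(d+1)` oriented unit steps. [folklore] -/
private theorem nbr_ite_eq_sum (x y : Fin (d + 1) → ℤ) (t : ℝ) :
    (if y ∈ nbrs x then t else 0)
      = ∑ μ : Fin (d + 1), ((if y = x + e1 μ then t else 0) + (if x = y + e1 μ then t else 0)) := by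
  by_cases hm : y ∈ nbrs x
  · rw [if_pos hm]
    obtain ⟨i, hi | hi⟩ := mem_nbrs.1 hm
    · have hi' : y = x + e1 i := hi
      have h1 : ∀ μ, (y = x + e1 μ) ↔ i = μ := fun μ => by rw [hi', add_right_inj, e1_inj]
      have h2 : ∀ μ, ¬ (x = y + e1 μ) := fun μ h => ne_add_e1_add_e1 x i μ (by rw [← hi']; exact h)
      simp only [h1, h2, if_false, add_zero, Finset.sum_ite_eq, Finset.mem_univ, if_true]
    · have hi' : x = y + e1 i := by rw [hi]; simp [e1]
      have h1 : ∀ μ, (x = y + e1 μ) ↔ i = μ := fun μ => by rw [hi', add_right_inj, e1_inj]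
      have h2 : ∀ μ, ¬ (y = x + e1 μ) := fun μ h => ne_add_e1_add_e1 y i μ (by rw [← hi']; exact h)
      simp only [h1, h2, if_false, zero_add, Finset.sum_ite_eq, Finset.mem_univ, if_true]
  · rw [if_neg hm]
    have h1 : ∀ μ, ¬ (y = x + e1 μ) := fun μ h => hm (mem_nbrs.2 ⟨μ, Or.inl h⟩)
    have h2 : ∀ μ, ¬ (x = y + e1 μ) := fun μ h => hm (mem_nbrs.2 ⟨μ, Or.inr (by rw [h]; simp [e1])⟩)
    simp only [h1, h2, if_false, add_zero, Finset.sum_const_zero]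

/-- **b04's BOND FORM (1.3) OF THE UNIT LATTICE (mesh parameter `L`, links `U(A(⟨x,x+e_μ⟩))`) IS
`L²·Σ_{⟨x,x′⟩⊂Ω^{(k)}}|U(A(⟨x,x′⟩))φ(x′) − φ(x)|²`**, the first sum of (5.2) (p35's `covDiffSq`): each unordered unit bond of
`Ω^{(k)}` is counted twice with weight `L²/2`, and the reversed orientation contributes the same square by orthogonality.
[cite: Balaban1983RegularityDecay, p. 593 (5.2), p. 572 (1.3)] -/
theorem covLap_unit_form (ψ : ↥(fineDom L Zc) × ι → ℝ) :
    ψ ⬝ᵥ (covLap (regWt L (fineDom L Zc)) (linkR F κ L Zc (uField n Ac)) *ᵥ ψ)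
      = (L : ℝ) ^ 2 * covDiffSq F κ Ac n (fineDom L Zc) ψ := by
  rw [covLap_form]
  set Tm : ↥(fineDom L Zc) → ↥(fineDom L Zc) → ℝ := fun x y =>
    (linkR F κ L Zc (uField n Ac) x y *ᵥ fld ψ y - fld ψ x) ⬝ᵥ
      (linkR F κ L Zc (uField n Ac) x y *ᵥ fld ψ y - fld ψ x) with hTm
  -- orthogonality and antisymmetry of the links
  have hWt : ∀ x y : ↥(fineDom L Zc),
      linkR F κ L Zc (uField n Ac) y x = (linkR F κ L Zc (uField n Ac) x y)ᵀ := fun x y => by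
    simp only [linkR, fieldLink]
    rw [compField_swap, mul_neg, F.transpose_eq]
  have hO1 : ∀ x y : ↥(fineDom L Zc),
      (linkR F κ L Zc (uField n Ac) x y)ᵀ * linkR F κ L Zc (uField n Ac) x y = 1 := fun x y => by
    simp only [linkR, fieldLink]
    exact F.orth _
  have hO2 : ∀ x y : ↥(fineDom L Zc),
      linkR F κ L Zc (uField n Ac) x y * (linkR F κ L Zc (uField n Ac) x y)ᵀ = 1 := fun x y => by
    simp only [linkR, fieldLink]
    rw [F.transpose_eq, ← F.map_add, add_neg_cancel, F.map_zero]
  have hsymm : ∀ x y : ↥(fineDom L Zc), Tm y x = Tm x y := fun x y => by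
    simp only [hTm]
    rw [hWt x y]
    have : (linkR F κ L Zc (uField n Ac) x y)ᵀ *ᵥ fld ψ x - fld ψ y
        = (linkR F κ L Zc (uField n Ac) x y)ᵀ *ᵥ (fld ψ x - linkR F κ L Zc (uField n Ac) x y *ᵥ fld ψ y) := by
      rw [Matrix.mulVec_sub, Matrix.mulVec_mulVec, hO1, Matrix.one_mulVec]
    rw [this, orth_dotProduct_mulVec_self (by rw [Matrix.transpose_transpose]; exact hO2 x y), ← neg_sub,
      neg_dotProduct, dotProduct_neg, neg_neg]
  -- the oriented bond terms of `covDiffSq`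
  set P : Fin (d + 1) → ↥(fineDom L Zc) → ℝ := fun μ x =>
    if h : x.1 + e1 μ ∈ fineDom L Zc then Tm x ⟨x.1 + e1 μ, h⟩ else 0 with hP
  have hcd : covDiffSq F κ Ac n (fineDom L Zc) ψ = ∑ x, ∑ μ, P μ x := by
    unfold covDiffSq
    refine Finset.sum_congr rfl fun x _ => Finset.sum_congr rfl fun μ _ => ?_
    by_cases h : x.1 + e1 μ ∈ fineDom L Zc
    · simp only [hP]
      rw [dif_pos h, dif_pos h]
      simp only [hTm]
      rw [linkR_uField_step F κ Zc n Ac x ⟨x.1 + e1 μ, h⟩ rfl]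
    · simp only [hP]
      rw [dif_neg h, dif_neg h]
  -- weights
  have h1 : ∀ x y : ↥(fineDom L Zc), regWt L (fineDom L Zc) x y * Tm x y
      = (L : ℝ) ^ 2 / 2 * (if y.1 ∈ nbrs x.1 then Tm x y else 0) := by
    intro x y
    unfold regWt
    split_ifs <;> ring
  have h2 : ∀ x y : ↥(fineDom L Zc), (if y.1 ∈ nbrs x.1 then Tm x y else 0)
      = ∑ μ, ((if y.1 = x.1 + e1 μ then Tm x y else 0) + (if x.1 = y.1 + e1 μ then Tm x y else 0)) :=
    fun x y => nbr_ite_eq_sum x.1 y.1 (Tm x y)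
  have hA : ∀ μ : Fin (d + 1),
      ∑ x : ↥(fineDom L Zc), ∑ y : ↥(fineDom L Zc), (if y.1 = x.1 + e1 μ then Tm x y else 0) = ∑ x, P μ x := by
    intro μ
    refine Finset.sum_congr rfl fun x _ => ?_
    rw [sum_subtype_ite_eq (x.1 + e1 μ) (fun y => Tm x y)]
  have hB : ∀ μ : Fin (d + 1),
      ∑ x : ↥(fineDom L Zc), ∑ y : ↥(fineDom L Zc), (if x.1 = y.1 + e1 μ then Tm x y else 0) = ∑ y, P μ y := by
    intro μ
    rw [Finset.sum_comm]
    refine Finset.sum_congr rfl fun y _ => ?_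
    rw [sum_subtype_ite_eq (y.1 + e1 μ) (fun x => Tm x y)]
    simp only [hP]
    split_ifs with h
    · exact hsymm _ _
    · rfl
  calc ∑ x, ∑ y, regWt L (fineDom L Zc) x y * Tm x y
      = ∑ x : ↥(fineDom L Zc), ∑ y : ↥(fineDom L Zc), (L : ℝ) ^ 2 / 2 *
          ∑ μ, ((if y.1 = x.1 + e1 μ then Tm x y else 0) + (if x.1 = y.1 + e1 μ then Tm x y else 0)) := by
        refine Finset.sum_congr rfl fun x _ => Finset.sum_congr rfl fun y _ => ?_
        rw [h1, h2]
    _ = (L : ℝ) ^ 2 / 2 * ∑ μ, ((∑ x : ↥(fineDom L Zc), ∑ y : ↥(fineDom L Zc),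
            if y.1 = x.1 + e1 μ then Tm x y else 0)
          + (∑ x : ↥(fineDom L Zc), ∑ y : ↥(fineDom L Zc), if x.1 = y.1 + e1 μ then Tm x y else 0)) := by
        simp only [← Finset.mul_sum]
        congr 1
        rw [sum_sum_sum_comm3]
        exact Finset.sum_congr rfl fun μ _ => by simp only [Finset.sum_add_distrib]
    _ = (L : ℝ) ^ 2 / 2 * ∑ μ, ((∑ x, P μ x) + (∑ x, P μ x)) := by
        congr 1
        exact Finset.sum_congr rfl fun μ _ => by rw [hA, hB]
    _ = (L : ℝ) ^ 2 * ∑ x, ∑ μ, P μ x := by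
        have h2s : ∀ μ : Fin (d + 1), (∑ x : ↥(fineDom L Zc), P μ x) + (∑ x, P μ x) = 2 * ∑ x, P μ x :=
          fun μ => by ring
        simp only [h2s, ← Finset.mul_sum]
        rw [Finset.sum_comm]
        ring
    _ = (L : ℝ) ^ 2 * covDiffSq F κ Ac n (fineDom L Zc) ψ := by rw [hcd]

end Unit

end

end Literature.MathematicalPhysics.QuantumFieldTheory.Balaban1983to89.B4NextAvg52
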